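import Summits.BirchSwinnertonDyer.Rank1Residual.X11b.RungK2Leaves
import Summits.BirchSwinnertonDyer.Rank1Residual.X11b.HalvesReceptacle
import Summits.BirchSwinnertonDyer.Rank1Residual.X11b.Three.StepLHalves
import Literature.NumberTheory.EllipticCurves.BDPAnticyclotomicPAdicLFunction
import Summits.BirchSwinnertonDyer.BirchSwinnertonDyer.Theses.ErratumRoadFive
import Summits.BirchSwinnertonDyer.BirchSwinnertonDyer.Theorems.ErratumRoadFiveControlFromJSWMult
import Summits.BirchSwinnertonDyer.BirchSwinnertonDyer.Theorems.ClassRecordThreeStepLOfHalvesB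
import Summits.BirchSwinnertonDyer.BirchSwinnertonDyer.Theorems.ErratumRoadFiveRest3TorsionBranchB
import Summits.BirchSwinnertonDyer.BirchSwinnertonDyer.Theorems.ErratumRoadFiveOpenInputNotRamStubImcDivSomeFrameNotRamB

/-!
# Crux `OpenInputNotRam` (item stmt-BirchSwinnertonDyer-19282, route `ErratumRoadFive`) — SECOND LINE «λ-MATCHING
# TRANSFER» (ROAD B12): the registered v3B atom-stub `stub_imcDivSomeFrameNotRamB` CUT into its two honest open
# shapes UB|¬ram (ONE Euler-system divisibility for E at p ∥ N — memo-proved class-wide, PROOF-BDP §38.8∕§38.10∕§39∕§41)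
# and INV|¬ram (matching Iwasawa invariants from a p-congruent good-ordinary partner — §37.11∕§40∕§42), plus two
# CITABLE FACT LEAVES; composition sorry-free via bdp g18's p516836 and v3B's `OpenInputNotRam_of_atomB`

Cell `bsd-stepL` (run/shared/lean/pub/bsd-stepL/), seat `bsd-stepL-bdp` (prover g18, 2026-08-27), plan g32 RULING 15 (D)(b)
(«re-thread of the ¬ram stub with YOUR bricks as typed binders»). DELIVERED to the planner (HOME/bdp/orientNR/); NOT
registered by this seat. Namespace `…Cruxes.OpenInputNotRam.LambdaMatching` (disjoint from the registered `…Birth`).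
Stubs (4 ≤ stubs_max): `stub_nr_ub` (UB|¬ram — DECIDING; = p507771's hUB universally quantified behind `¬ Ram W p`),
`stub_nr_inv` (INV|¬ram), `stub_nr_factsHsiehBDP` (citable leaf: Hsieh 2014 Thm 5.6 ∧ BDP13 Thm 5.5, the two REFEREED
named facts feeding the frame — p471323∕p512577), `stub_nr_castellaPNewDisplay` (citable leaf, as in v3B).
`OpenInputNotRam_of_lambdaMatching (hF : PublishedInputsFive) (hB) (hHR) (hub) (hinv)` concludes the ROUTE DECL BY NAME.
Card: PROOF-BDP §37 (mechanism), §38.4∕§42 (loci∕partners: 574 of 751 ¬Ram finite-flat pairs at p = 5 have a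
Cremona partner + K), §43 (UB is class-wide). HONEST FRAMING: sorries ONLY in `stub_*`; nothing booked (T7); BSD is not
proved for any class; INV|¬ram is EMPTY off the finite-flat sub-locus (no partner) — there the line does not apply and
the A-line (v3B `OpenInputNotRam_of`) ∕ the 19282-BULK residual statement (§38.5) stand.
-/

set_option linter.dupNamespace false

noncomputable section

open scoped Classical NumberField

open WeierstrassCurve NumberField IsDedekindDomain Field PowerSeries
  Literature.NumberTheory.EllipticCurves Literature.NumberTheory.EllipticCurves.ModularForms
  Literature.NumberTheory.EllipticCurves.Rank1Residual
  Literature.NumberTheory.GaloisRepresentations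
  Summit.BirchSwinnertonDyer.Rank1Residual Summit.BirchSwinnertonDyer.Rank1Residual.X11b
  Summit.BirchSwinnertonDyer.Rank1Residual.X11b.AcSelmer
  Summit.BirchSwinnertonDyer.Rank1Residual.X11b.Halves
  Summit.BirchSwinnertonDyer.Rank1Residual.X1.KellerYinHalves

namespace Summit.BirchSwinnertonDyer.BirchSwinnertonDyer.Cruxes.OpenInputNotRam.LambdaMatching

/-- **stub UB|¬ram — ONE Euler-system-side divisibility for E at p ∥ N (DECIDING stub of this line)**: on every (¬ram)
pair, at every classical datum and every `R₀`-frame at `(ι', 𝔭_{ι'})`, for every X-slot `𝔭bar ≠ 𝔭_{ι'}`: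
`∃ k, p^k·L ∈ Ch_Λ(X_ac 𝔭bar)·R₀⟦T⟧`. Memo-proved class-wide at p ≥ 5 (PROOF-BDP §38.8∕§38.10∕§39 non-split, §41
split; referee grants owed); NOT in print at p ∣ N (lit g19 EPS3 §E.1). -/
theorem stub_nr_ub :
    ∀ (W : WeierstrassCurve ℚ) [W.IsElliptic] [W.IsGloballyMinimal] (p : ℕ) [Fact p.Prime],
      ¬ Literature.NumberTheory.EllipticCurves.Rank1Residual.Ram W p →
      ∀ (N : ℕ) [NeZero N] (K : Type) [Field K] [NumberField K]
        (Dt : ModularParametrizationData W N) (H : HeegnerDatum N (NumberField.discr K)) (ι : K →+* ℂ)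
        (P : (W.baseChange K).toAffine.Point),
        ClassX11b W p → 5 ≤ p → Surj W p → W.conductorNorm ℤ = N → IsImaginaryQuadratic K →
        Odd (NumberField.discr K) → ¬ (p : ℤ) ∣ NumberField.discr K → ¬ p ∣ Units.torsionOrder K →
        SatisfiesHeegnerHypothesis N K →
        (W.quadraticTwist (NumberField.discr K : ℚ)).entireLFunction 1 ≠ 0 →
        WeierstrassCurve.Affine.Point.map ι.toRatAlgHom P = heegnerPointComplex Dt H →
        ¬ (p : ℤ) ∣ Dt.c → ¬ IsOfFinAddOrder P →
        ∀ (κ : ZpExtension K p), κ.IsAnticyclotomic →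
          ∀ (γ : Field.absoluteGaloisGroup K) [Fact (κ.IsTopGenerator γ)]
            (ι' : PadicAlgCl p ≃+* ℂ) (w₀ : InfinitePlace K) (P' : (W.baseChange K).toAffine.Point),
            WeierstrassCurve.Affine.Point.map w₀.embedding.toRatAlgHom P' = heegnerPointComplex Dt H →
            ∀ (e : K →+* ℚ_[p]),
              (∀ k : 𝓞 K, k ∈ (primeOfEmbeddingDatum p ι' w₀.embedding).asIdeal ↔ ‖e (k : K)‖ < 1) →
              ∀ (ΩK : ℂ) (Ωp : (unrIntegers p)ˣ) (L : UnrSeries p), ΩK ≠ 0 →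
                IsBDPLFunction ι' (primeOfEmbeddingDatum p ι' w₀.embedding) κ γ Dt.f ΩK
                  ((Ωp : unrIntegers p) : ℂ_[p]) L →
                ∀ (𝔭bar : HeightOneSpectrum (𝓞 K)), ((p : ℕ) : 𝓞 K) ∈ 𝔭bar.asIdeal →
                  𝔭bar ≠ primeOfEmbeddingDatum p ι' w₀.embedding →
                  ∃ k : ℕ, C (((p : ℕ) : unrIntegers p) ^ k) * L ∈
                    (XAc.charIdeal (W.baseChange K) p κ 𝔭bar ∅ γ).map (PowerSeries.map (toUnr p)) := by
  sorry

/-- **stub INV|¬ram — matching Iwasawa invariants**: same binders; a generator `g` of `Ch_Λ(X_ac 𝔭bar)` and the frame's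
`L` have `μ = 0` and their first unit coefficient (read in `R₀`) at the SAME index. Memo-grade via a p-congruent GOOD
ORDINARY partner E′ (exists iff E[p] finite flat at p; §42: 574∕751 ¬Ram finite-flat pairs at p = 5 have one in
Cremona's table with a common Heegner K): (ε1) BCS25 Thm 1.2.4 (PUB, flag), (ε2-an) §40, (ε2-alg) §37.11, algebra
p510403 `LambdaMatching.invariantsMatch_of_transfer`. -/
theorem stub_nr_inv :
    ∀ (W : WeierstrassCurve ℚ) [W.IsElliptic] [W.IsGloballyMinimal] (p : ℕ) [Fact p.Prime],
      ¬ Literature.NumberTheory.EllipticCurves.Rank1Residual.Ram W p →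
      ∀ (N : ℕ) [NeZero N] (K : Type) [Field K] [NumberField K]
        (Dt : ModularParametrizationData W N) (H : HeegnerDatum N (NumberField.discr K)) (ι : K →+* ℂ)
        (P : (W.baseChange K).toAffine.Point),
        ClassX11b W p → 5 ≤ p → Surj W p → W.conductorNorm ℤ = N → IsImaginaryQuadratic K →
        Odd (NumberField.discr K) → ¬ (p : ℤ) ∣ NumberField.discr K → ¬ p ∣ Units.torsionOrder K →
        SatisfiesHeegnerHypothesis N K →
        (W.quadraticTwist (NumberField.discr K : ℚ)).entireLFunction 1 ≠ 0 →
        WeierstrassCurve.Affine.Point.map ι.toRatAlgHom P = heegnerPointComplex Dt H →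
        ¬ (p : ℤ) ∣ Dt.c → ¬ IsOfFinAddOrder P →
        ∀ (κ : ZpExtension K p), κ.IsAnticyclotomic →
          ∀ (γ : Field.absoluteGaloisGroup K) [Fact (κ.IsTopGenerator γ)]
            (ι' : PadicAlgCl p ≃+* ℂ) (w₀ : InfinitePlace K) (P' : (W.baseChange K).toAffine.Point),
            WeierstrassCurve.Affine.Point.map w₀.embedding.toRatAlgHom P' = heegnerPointComplex Dt H →
            ∀ (e : K →+* ℚ_[p]),
              (∀ k : 𝓞 K, k ∈ (primeOfEmbeddingDatum p ι' w₀.embedding).asIdeal ↔ ‖e (k : K)‖ < 1) →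
              ∀ (ΩK : ℂ) (Ωp : (unrIntegers p)ˣ) (L : UnrSeries p), ΩK ≠ 0 →
                IsBDPLFunction ι' (primeOfEmbeddingDatum p ι' w₀.embedding) κ γ Dt.f ΩK
                  ((Ωp : unrIntegers p) : ℂ_[p]) L →
                ∀ (𝔭bar : HeightOneSpectrum (𝓞 K)), ((p : ℕ) : 𝓞 K) ∈ 𝔭bar.asIdeal →
                  𝔭bar ≠ primeOfEmbeddingDatum p ι' w₀.embedding →
                  ∃ (g : IwasawaAlgebra p) (n : ℕ),
                    XAc.charIdeal (W.baseChange K) p κ 𝔭bar ∅ γ = Ideal.span {g} ∧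
                    (‖((coeff n (PowerSeries.map (toUnr p) g) : unrIntegers p) : ℂ_[p])‖ = 1 ∧
                      ∀ i < n, ‖((coeff i (PowerSeries.map (toUnr p) g) : unrIntegers p) : ℂ_[p])‖ < 1) ∧
                    (‖((coeff n L : unrIntegers p) : ℂ_[p])‖ = 1 ∧
                      ∀ i < n, ‖((coeff i L : unrIntegers p) : ℂ_[p])‖ < 1) := by
  sorry

/-- **F0 · `stub_nr_factsHsiehBDP` — CITABLE FACT LEAF (not a genuine stub)**: the two REFEREED named facts feeding the
`R₀`-frame at every odd p ∥ N (nram2 p471323 ∕ bdp p512577): Hsieh, Doc. Math. 19 (2014) Thm 5.6 (period in `𝒲^×`) and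
Bertolini–Darmon–Prasanna, Duke 162 (2013) Thm 5.5 (central-value reciprocity), BY NAME.
[cite: Hsieh2014, Thm. 5.6 (arXiv:1112.1580 p. 23)] [cite: BertoliniDarmonPrasanna2013, Thm. 5.5] -/
theorem stub_nr_factsHsiehBDP :
    Literature.NumberTheory.EllipticCurves.hsieh2014_exists_anticyclotomicPAdicLFunction_unrPeriod ∧
      Literature.NumberTheory.EllipticCurves.bertoliniDarmonPrasanna2013_centralValue_reciprocity := by
  sorry

/-- **F1 · `stub_nr_castellaPNewDisplay` — CITABLE FACT LEAF** (as in the registered v3B line): Castella JIMJ 17 (2018)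
Thms. 2.10–2.11 BY NAME. [cite: Castella2018Exceptional, Thms. 2.10–2.11 (arXiv:1507.04260 pp. 13–14)] -/
theorem stub_nr_castellaPNewDisplay :
    Literature.NumberTheory.EllipticCurves.Castella2018Exceptional.thm210_thm211_bdpDisplay_pNew := by
  sorry

namespace Statement

/-- Statement of `stub_nr_ub`. -/
abbrev stub_nr_ub : Prop := type_of% @LambdaMatching.stub_nr_ub
/-- Statement of `stub_nr_inv`. -/
abbrev stub_nr_inv : Prop := type_of% @LambdaMatching.stub_nr_inv
/-- Statement of `stub_nr_factsHsiehBDP` (citable fact leaf). -/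
abbrev stub_nr_factsHsiehBDP : Prop := type_of% @LambdaMatching.stub_nr_factsHsiehBDP
/-- Statement of `stub_nr_castellaPNewDisplay` (citable fact leaf). -/
abbrev stub_nr_castellaPNewDisplay : Prop := type_of% @LambdaMatching.stub_nr_castellaPNewDisplay

end Statement

/-- **`OpenInputNotRam_of_lambdaMatching`** — the crux BY NAME along ROAD B12: UB|¬ram + INV|¬ram + the two frame facts
⟹ the atom on (¬ram) (bdp g18 p516836 `openInputNotRam_stub_imcDivSomeFrameNotRamB_of_facts_of_ratUpperBound_of_invariantsMatch`),
then v3B's value-free passage `Birth.OpenInputNotRam_of_atomB` (PublishedInputsFive + the JIMJ18 leaf). Sorry-free.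
[cite: Castella2018Erratum, (2.4) (p. 4)] [cite: Washington1997, §7.1 Prop. 7.2 and §13.2] -/
theorem OpenInputNotRam_of_lambdaMatching
    (hF : Summit.BirchSwinnertonDyer.BirchSwinnertonDyer.Theses.ErratumRoadFive.PublishedInputsFive)
    (hB : Statement.stub_nr_castellaPNewDisplay) (hHR : Statement.stub_nr_factsHsiehBDP)
    (hub : Statement.stub_nr_ub) (hinv : Statement.stub_nr_inv) :
    Summit.BirchSwinnertonDyer.BirchSwinnertonDyer.Theses.ErratumRoadFive.OpenInputNotRam := by
  -- = v3B's `Birth.OpenInputNotRam_of_atomB` with its atom-stub fed by p516836 (inlined: same four lines)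
  have h1 := Summit.BirchSwinnertonDyer.BirchSwinnertonDyer.Theorems.openInputNotRam_stub_imcDivSomeFrameNotRamB_of_facts_of_ratUpperBound_of_invariantsMatch
    hHR.1 hHR.2 hub hinv
  obtain ⟨-, hKo, -, -, -, hGZK, -, hnf, -, -, -, -, -, hPT, hEP⟩ := hF
  unfold Summit.BirchSwinnertonDyer.BirchSwinnertonDyer.Theses.ErratumRoadFive.OpenInputNotRam
  intro W _ _ p _ hnr
  exact Summit.BirchSwinnertonDyer.BirchSwinnertonDyer.Theorems.Rest3TorsionBranchB.openInputOnTreeAt_of_imcDivSomeFrameB_of_pNew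
    hnf hGZK hKo hPT hEP hB (h1 W p hnr)

/-- The crux along ROAD B12, MODULO exactly the registered-shape stubs (sorries live only in `stub_*`); `PublishedInputsFive`
enters as the route's own support item (as in v3B's `_of_atomB`). -/
theorem OpenInputNotRam_proof_lambdaMatching
    (hF : Summit.BirchSwinnertonDyer.BirchSwinnertonDyer.Theses.ErratumRoadFive.PublishedInputsFive) :
    Summit.BirchSwinnertonDyer.BirchSwinnertonDyer.Theses.ErratumRoadFive.OpenInputNotRam :=
  OpenInputNotRam_of_lambdaMatching hF stub_nr_castellaPNewDisplay stub_nr_factsHsiehBDP stub_nr_ub stub_nr_inv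

end Summit.BirchSwinnertonDyer.BirchSwinnertonDyer.Cruxes.OpenInputNotRam.LambdaMatching

end
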